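import Summits.ResolutionOfSingularities.ResolutionOfSingularities.Theorems.MarkedTransferCampaignW46MohWindowShadeExit
import Summits.ResolutionOfSingularities.ResolutionOfSingularities.Theorems.MarkedTransferCampaignW46MohWindowShadeDecrease
import Summits.ResolutionOfSingularities.ResolutionOfSingularities.Theorems.MarkedTransferCampaignW46MohWindowShadeExitStatement

/-!
# [OURS · L1 W4.6] Rung (iii) "Moh window" for the classical pair, EXIT half — the four OURS predicates of
  `MarkedTransferCampaignW46MohWindowShadeExitStatement.lean` HOLD (closers by name)

Cell `res-hironaka`, rung L, slot W4.6, seat `res-L1-s46-pv-6` (gen 2).  One-line closers onto the proof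
files `MarkedTransferCampaignW46MohWindowShadeExit.lean` (p484733) and `…ShadeTerminal.lean` (p484162):
every predicate holds for every prime `p`, every field `K` of characteristic `p`, every finite `σ`.  OURS;
NOT statements of the manuscript [claim: Hironaka2017, status: under-review], nothing of which is used.
AI review is weaker than expert review.
-/

noncomputable section

set_option linter.dupNamespace false -- mandated namespace of this single-conjunct summit

namespace Summit.ResolutionOfSingularities.ResolutionOfSingularities.Theorems

open Literature.AlgebraicGeometry.Resolution
open Literature.AlgebraicGeometry.Resolution.Hauser2010

variable (p : ℕ) [Fact p.Prime] (K : Type*) [Field K] [DecidableEq K] [CharP K p]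
variable (σ : Type*) [Fintype σ] [DecidableEq σ]

/-- **[OURS · L1 W4.6] `CampaignW46MohWindowShadeBottomExit` holds**: for surfaces a cleaned state of
order exactly `p` has no equimultiple point (closer; proof =
`CampaignW46.MohWindowShadeExit.not_isEquimultiplePoint_of_two_vars`).  NOT a statement of the
manuscript. -/
theorem campaignW46MohWindowShadeBottomExit_holds : CampaignW46MohWindowShadeBottomExit p K σ :=
  fun _j _i hij htwo b hbj s hclean hord =>
    CampaignW46.MohWindowShadeExit.not_isEquimultiplePoint_of_two_vars p hij htwo b hbj s hclean hord

omit [Fact p.Prime] in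
/-- **[OURS · L1 W4.6] `CampaignW46MohWindowShadeTerminalStable` holds**: inside the window a
coordinate-monomial state steps to a coordinate-monomial state, equimultiple iff `p ≤ |r'|` (closer;
proofs = `CampaignW46.MohWindowShadeTerminal.ordZero_step_eq_of_shade_zero`,
`shade_step_eq_zero_of_shade_zero`, `isEquimultiplePoint_iff_of_shade_zero`).  NOT a statement of the
manuscript. -/
theorem campaignW46MohWindowShadeTerminalStable_holds : CampaignW46MohWindowShadeTerminalStable p K σ :=
  fun j b hbj s hr hord hlo hhi =>
    ⟨CampaignW46.MohWindowShadeTerminal.ordZero_step_eq_of_shade_zero p j b hbj s hr hord hlo hhi,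
      CampaignW46.MohWindowShadeTerminal.shade_step_eq_zero_of_shade_zero p j b hbj s hr hord hlo hhi,
      CampaignW46.MohWindowShadeTerminal.isEquimultiplePoint_iff_of_shade_zero p j b hbj s hr hord hlo⟩

/-- **[OURS · L1 W4.6] `CampaignW46MohWindowShadeTerminalTerminates` holds**: no proper centre ⟹ every
walk of `p`-fold points from a terminal state inside the window has `N + p ≤ |r₀|` (closer; proof =
`CampaignW46.MohWindowShadeTerminal.length_le_of_noProperCentre`).  NOT a statement of the manuscript. -/
theorem campaignW46MohWindowShadeTerminalTerminates_holds :
    CampaignW46MohWindowShadeTerminalTerminates p K σ :=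
  fun s j b hb hstep hclean hr hord hlo hhi hnpc _N heq =>
    CampaignW46.MohWindowShadeTerminal.length_le_of_noProperCentre p s j b hb hstep hclean hr hord hlo
      hhi hnpc heq

/-- **[OURS · L1 W4.6] `CampaignW46MohWindowShadeAntitoneFin` holds**: the no-increase law along a finite
walk (closer; proof = `CampaignW46.MohWindowShadeExit.shade_antitone_along_of_window_fin`).  NOT a
statement of the manuscript. -/
theorem campaignW46MohWindowShadeAntitoneFin_holds : CampaignW46MohWindowShadeAntitoneFin p K σ :=
  fun s j b hb hstep hclean hr hord0 _N heq hwin _n _m hnm hmN =>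
    CampaignW46.MohWindowShadeExit.shade_antitone_along_of_window_fin p s j b hb hstep hclean hr hord0
      heq hwin hnm hmN


/-! ## v2 (gen 2, APPEND-ONLY): closers of the decrease laws (statement file v5) -/

omit [Fact p.Prime] in
/-- **[OURS · L1 W4.6] `CampaignW46MohWindowShadeChartDecrease` holds** (closer; proof =
`CampaignW46.MohWindowShadeDecrease.shade_step_add_le_of_forall`).  NOT a statement of the manuscript. -/
theorem campaignW46MohWindowShadeChartDecrease_holds : CampaignW46MohWindowShadeChartDecrease p K σ :=
  fun j b hbj s _o ho hlo hhi hr _m hm =>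
    CampaignW46.MohWindowShadeDecrease.shade_step_add_le_of_forall p j b hbj s ho hlo hhi hr hm

omit [Fact p.Prime] in
/-- **[OURS · L1 W4.6] `CampaignW46MohWindowShadeOriginDecrease` holds** (closer; proof =
`CampaignW46.MohWindowShadeDecrease.shade_step_add_le_origin`).  NOT a statement of the manuscript. -/
theorem campaignW46MohWindowShadeOriginDecrease_holds : CampaignW46MohWindowShadeOriginDecrease p K σ :=
  fun j b hb0 s _o ho hlo hhi hr _M _d₀ hd₀ hd₀deg hM =>
    CampaignW46.MohWindowShadeDecrease.shade_step_add_le_origin p j b hb0 s ho hlo hhi hr hd₀ hd₀deg hM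

end Summit.ResolutionOfSingularities.ResolutionOfSingularities.Theorems
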